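import Summits.KontsevichZagierPeriods.KontsevichZagierPeriods.Theorems.RootDecompWalshStrataConicClamp

/-!
# Conic descent 3/7: square-root descent (statement), conic data, the cell with `A < 0`

`SqrtDescent e f g γ` := every 1-dim representation with integrand `γ·√(e t² + f t + g)` on its
domain lands in the Baker sector (mod relations).  `structure Conic` (coefficients of
`A y² + B(x) y + C(x)`), its discriminant `D = B² − 4AC = e x² + f x + g`, root functions
`(−B ± √D)/(2A)` (semialgebraic), the Walsh cell, and **`inBaker_cell_of_neg`**: for `A < 0` the cell
is the open band between the clamped roots over `{D > 0} ∩ (0,1)` (up to a null set), so the band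
identity + clamp descent + `SqrtDescent` put `[cell, q]` in the Baker sector.
Imports: part 2; 0 sorry. [KontsevichZagier2001 §1.2; BCR1998 §2.2]
-/

noncomputable section

open Literature.NumberTheory.Transcendental
open MeasureTheory Set
open MvPolynomial (aeval X C)
open Literature.ModelTheory.ExponentialFields (IsSemialgebraic isSemialgebraic_univ
  isSemialgebraic_setOf_eval_pos isSemialgebraic_setOf_eval_lt isSemialgebraic_setOf_eval_le
  isSemialgebraic_setOf_eval_nonneg isSemialgebraic_setOf_eval_eq_zero continuous_aeval_real
  tarski_seidenberg_real_holds)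
open Summit.KontsevichZagierPeriods.RootDecompWalshStrata.WalshSpanProof (isSemialgebraic_cubeSet
  isBounded_cubeSet)
open Summit.KontsevichZagierPeriods.RootDecompWalshStrata.ConeSpecimen (unitIoo isSemialgebraic_unitIoo
  unitIoo_subset_Icc mem_unitIoo)

namespace Summit.KontsevichZagierPeriods.RootDecompWalshStrata.ConicDescent

/-! #### 6. Square-root descent (statement) and the conic data -/

/-- **Square-root descent** for the weight `γ·√(e t² + f t + g)`: every one-dimensional
representation with that integrand lands in the Baker sector. Proved below (`sqrtDescent_holds`) by
rationalising substitutions; isolated as a statement so that the conic assembly is checked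
independently of the charts. [this node] -/
def SqrtDescent (e f g γ : ℚ) : Prop :=
  ∀ r : KZ.IntegralRep 1,
    EqOn r.integrand (fun v => (γ : ℝ) * √((e : ℝ) * v 0 ^ 2 + f * v 0 + g)) r.domain →
      InBaker (KZ.of r)

/-- Coefficients of a conic `A y² + (b₀ + b₁ x) y + (c₀ + c₁ x + c₂ x²)` over `ℚ`. -/
structure Conic where
  /-- the coefficient `A` of `y²` -/
  A : ℚ
  /-- the constant coefficient of `B(x)` -/
  b0 : ℚ
  /-- the coefficient of `x` in `B(x)` -/
  b1 : ℚ
  /-- the constant coefficient of `C(x)` -/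
  c0 : ℚ
  /-- the coefficient of `x` in `C(x)` -/
  c1 : ℚ
  /-- the coefficient of `x²` in `C(x)` -/
  c2 : ℚ

namespace Conic

variable (K : Conic)

/-- `B(x) = b₀ + b₁ x`. -/
def Bx (x : ℝ) : ℝ := K.b0 + K.b1 * x
/-- `C(x) = c₀ + c₁ x + c₂ x²`. -/
def Cx (x : ℝ) : ℝ := K.c0 + K.c1 * x + K.c2 * x ^ 2
/-- The discriminant `D(x) = B(x)² − 4 A C(x)`. -/
def Dx (x : ℝ) : ℝ := K.Bx x ^ 2 - 4 * K.A * K.Cx x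
/-- The conic polynomial function `p(x, y)`. -/
def pxy (x y : ℝ) : ℝ := K.A * y ^ 2 + K.Bx x * y + K.Cx x
/-- The root `(−B + √D)/(2A)` (the LOWER root when `A < 0`). -/
def lox (x : ℝ) : ℝ := (-K.Bx x + √(K.Dx x)) / (2 * K.A)
/-- The root `(−B − √D)/(2A)` (the UPPER root when `A < 0`). -/
def hix (x : ℝ) : ℝ := (-K.Bx x - √(K.Dx x)) / (2 * K.A)
/-- Discriminant coefficients: `D(x) = e x² + f x + g`. -/
def e : ℚ := K.b1 ^ 2 - 4 * K.A * K.c2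
/-- The coefficient `f = 2 b₀ b₁ − 4 A c₁` of `x` in `D(x)`. [this node] -/
def f : ℚ := 2 * K.b0 * K.b1 - 4 * K.A * K.c1
/-- The constant coefficient `g = b₀² − 4 A c₀` of `D(x)`. [this node] -/
def g : ℚ := K.b0 ^ 2 - 4 * K.A * K.c0
/-- The opposite conic `−p`. -/
def neg : Conic := ⟨-K.A, -K.b0, -K.b1, -K.c0, -K.c1, -K.c2⟩
/-- The weighted conic Walsh cell `{(x,y) ∈ (0,1)² | p(x,y) > 0}`. -/
def cell : Set (Fin 2 → ℝ) := {z | (∀ j, 0 < z j ∧ z j < 1) ∧ 0 < K.pxy (z 0) (z 1)}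
/-- The polynomials `B`, `C`, `D` and `p` as `MvPolynomial`s. -/
def Bp : MvPolynomial (Fin 1) ℚ := MvPolynomial.C K.b0 + MvPolynomial.C K.b1 * X 0
/-- `C` as a polynomial over `ℚ` in one variable. [this node] -/
def Cp : MvPolynomial (Fin 1) ℚ :=
  MvPolynomial.C K.c0 + MvPolynomial.C K.c1 * X 0 + MvPolynomial.C K.c2 * X 0 ^ 2
/-- The discriminant `D = B² − 4AC` as a polynomial over `ℚ`. [this node] -/
def Dp : MvPolynomial (Fin 1) ℚ := K.Bp ^ 2 - 4 * MvPolynomial.C K.A * K.Cp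
/-- The conic `p(x,y) = A y² + B(x) y + C(x)` as a polynomial over `ℚ` in two variables. [this node] -/
def Pp : MvPolynomial (Fin 2) ℚ :=
  MvPolynomial.C K.A * X 1 ^ 2 + (MvPolynomial.C K.b0 + MvPolynomial.C K.b1 * X 0) * X 1 +
    (MvPolynomial.C K.c0 + MvPolynomial.C K.c1 * X 0 + MvPolynomial.C K.c2 * X 0 ^ 2)

/-- `D(x) = e x² + f x + g`. [this node] -/
theorem Dx_eq (x : ℝ) : K.Dx x = (K.e : ℝ) * x ^ 2 + K.f * x + K.g := by
  simp only [Dx, Bx, Cx, e, f, g]; push_cast; ring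

/-- Evaluation of `Bp` is `B`. [this node] -/
@[simp] theorem aeval_Bp (v : Fin 1 → ℝ) : aeval v K.Bp = K.Bx (v 0) := by simp [Bp, Bx]
/-- Evaluation of `Cp` is `C`. [this node] -/
@[simp] theorem aeval_Cp (v : Fin 1 → ℝ) : aeval v K.Cp = K.Cx (v 0) := by simp [Cp, Cx]
/-- Evaluation of `Dp` is `D`. [this node] -/
@[simp] theorem aeval_Dp (v : Fin 1 → ℝ) : aeval v K.Dp = K.Dx (v 0) := by
  simp [Dp, Dx, map_ofNat]
/-- Evaluation of `Pp` is `p`. [this node] -/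
@[simp] theorem aeval_Pp (z : Fin 2 → ℝ) : aeval z K.Pp = K.pxy (z 0) (z 1) := by
  simp [Pp, pxy, Bx, Cx]

/-- The opposite conic has the opposite polynomial function. [this node] -/
theorem neg_pxy (x y : ℝ) : K.neg.pxy x y = -K.pxy x y := by
  simp only [pxy, neg, Bx, Cx]; push_cast; ring
/-- `−p` has the same discriminant coefficient `e`. [this node] -/
theorem neg_e : K.neg.e = K.e := by simp only [e, neg]; ring
/-- `−p` has the same discriminant coefficient `f`. [this node] -/
theorem neg_f : K.neg.f = K.f := by simp only [f, neg]; ring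
/-- `−p` has the same discriminant coefficient `g`. [this node] -/
theorem neg_g : K.neg.g = K.g := by simp only [g, neg]; ring
/-- Coefficientwise sum of conics. -/
def add (K L : Conic) : Conic :=
  ⟨K.A + L.A, K.b0 + L.b0, K.b1 + L.b1, K.c0 + L.c0, K.c1 + L.c1, K.c2 + L.c2⟩
/-- The polynomial function of a sum of conics is the sum. [this node] -/
theorem add_pxy (K L : Conic) (x y : ℝ) : (K.add L).pxy x y = K.pxy x y + L.pxy x y := by
  simp only [pxy, add, Bx, Cx]; push_cast; ring

/-- `B` is a `ℚ`-semialgebraic function on any `ℚ`-semialgebraic set. [BCR1998 §2.2] -/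
theorem isSemialgebraicFunOn_Bx {X : Set (Fin 1 → ℝ)} (hX : IsSemialgebraic ℚ X) :
    IsSemialgebraicFunOn ℚ X fun v => K.Bx (v 0) :=
  (isSemialgebraicFunOn_aeval hX K.Bp).congr fun v _ => K.aeval_Bp v
/-- `C` is a `ℚ`-semialgebraic function on any `ℚ`-semialgebraic set. [BCR1998 §2.2] -/
theorem isSemialgebraicFunOn_Cx {X : Set (Fin 1 → ℝ)} (hX : IsSemialgebraic ℚ X) :
    IsSemialgebraicFunOn ℚ X fun v => K.Cx (v 0) :=
  (isSemialgebraicFunOn_aeval hX K.Cp).congr fun v _ => K.aeval_Cp v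
/-- `D` is a `ℚ`-semialgebraic function on any `ℚ`-semialgebraic set. [BCR1998 §2.2] -/
theorem isSemialgebraicFunOn_Dx {X : Set (Fin 1 → ℝ)} (hX : IsSemialgebraic ℚ X) :
    IsSemialgebraicFunOn ℚ X fun v => K.Dx (v 0) :=
  (isSemialgebraicFunOn_aeval hX K.Dp).congr fun v _ => K.aeval_Dp v
/-- The root function `(−B + √D)/(2A)` is `ℚ`-semialgebraic. [BCR1998 §2.2] -/
theorem isSemialgebraicFunOn_lox {X : Set (Fin 1 → ℝ)} (hX : IsSemialgebraic ℚ X) :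
    IsSemialgebraicFunOn ℚ X fun v => K.lox (v 0) :=
  (IsSemialgebraicFunOn.mul_holds (isSemialgebraicFunOn_ratCast hX (1 / (2 * K.A)))
    (IsSemialgebraicFunOn.add_holds (K.isSemialgebraicFunOn_Bx hX).neg
      (IsSemialgebraicFunOn.sqrt_holds (K.isSemialgebraicFunOn_Dx hX)))).congr fun v _ => by
    simp only [lox, Pi.mul_apply, Pi.add_apply, Pi.neg_apply]; push_cast; ring
/-- The root function `(−B − √D)/(2A)` is `ℚ`-semialgebraic. [BCR1998 §2.2] -/
theorem isSemialgebraicFunOn_hix {X : Set (Fin 1 → ℝ)} (hX : IsSemialgebraic ℚ X) :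
    IsSemialgebraicFunOn ℚ X fun v => K.hix (v 0) :=
  (IsSemialgebraicFunOn.mul_holds (isSemialgebraicFunOn_ratCast hX (1 / (2 * K.A)))
    (IsSemialgebraicFunOn.sub_holds (K.isSemialgebraicFunOn_Bx hX).neg
      (IsSemialgebraicFunOn.sqrt_holds (K.isSemialgebraicFunOn_Dx hX)))).congr fun v _ => by
    simp only [hix, Pi.mul_apply, Pi.sub_apply, Pi.neg_apply]; push_cast; ring

/-- The conic Walsh cell is `ℚ`-semialgebraic. [BCR1998 §2.2] -/
theorem isSemialgebraic_cell : IsSemialgebraic ℚ K.cell := by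
  convert (isSemialgebraic_cubeSet 2).inter (isSemialgebraic_setOf_eval_pos (R := ℝ) K.Pp) using 1
  ext z
  simp only [cell, mem_setOf_eq, mem_inter_iff, aeval_Pp]

/-- The conic Walsh cell lies in the unit cube. [folklore] -/
theorem cell_subset_Icc : K.cell ⊆ Icc 0 1 := fun _ hz =>
  ⟨fun j => (hz.1 j).1.le, fun j => (hz.1 j).2.le⟩

/-- `4A·p = (2Ay + B)² − D`. [folklore] -/
theorem key (x y : ℝ) : 4 * K.A * K.pxy x y = (2 * K.A * y + K.Bx x) ^ 2 - K.Dx x := by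
  simp only [pxy, Dx]; ring

/-- For `A < 0`: `p(x,y) > 0 ↔ D(x) > 0 ∧ lo(x) < y < hi(x)`. [folklore] -/
theorem pos_iff_of_neg (hA : K.A < 0) (x y : ℝ) :
    0 < K.pxy x y ↔ 0 < K.Dx x ∧ K.lox x < y ∧ y < K.hix x := by
  have hk := K.key x y
  have h2A : (2 : ℝ) * K.A < 0 := by
    have : (K.A : ℝ) < 0 := by exact_mod_cast hA
    linarith
  rw [lox, hix, div_lt_iff_of_neg h2A, lt_div_iff_of_neg h2A]
  constructor
  · intro hp
    have h4 : 4 * (K.A : ℝ) * K.pxy x y < 0 := by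
      have : (K.A : ℝ) < 0 := by exact_mod_cast hA
      nlinarith
    have hsq : (2 * K.A * y + K.Bx x) ^ 2 < K.Dx x := by linarith
    have hD : 0 < K.Dx x := lt_of_le_of_lt (sq_nonneg _) hsq
    have habs : |2 * K.A * y + K.Bx x| < √(K.Dx x) :=
      (Real.lt_sqrt (abs_nonneg _)).2 (by rwa [sq_abs])
    rw [abs_lt] at habs
    exact ⟨hD, by linarith [habs.2], by linarith [habs.1]⟩
  · rintro ⟨hD, h1, h2⟩
    have habs : |2 * K.A * y + K.Bx x| < √(K.Dx x) := by
      rw [abs_lt]; constructor <;> linarith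
    have hsq : (2 * K.A * y + K.Bx x) ^ 2 < K.Dx x := by
      have := (Real.lt_sqrt (abs_nonneg _)).1 habs
      rwa [sq_abs] at this
    have h4 : 4 * (K.A : ℝ) * K.pxy x y < 0 := by linarith
    have : (K.A : ℝ) < 0 := by exact_mod_cast hA
    nlinarith

/-- For `A ≠ 0`: a zero of `p(x, ·)` is one of the two roots. [folklore] -/
theorem eq_root_of_eq_zero (hA : K.A ≠ 0) (x y : ℝ) (h : K.pxy x y = 0) :
    0 ≤ K.Dx x ∧ (y = K.lox x ∨ y = K.hix x) := by
  have hk := K.key x y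
  rw [h, mul_zero] at hk
  have hD : K.Dx x = (2 * K.A * y + K.Bx x) ^ 2 := by linarith
  have hA' : (K.A : ℝ) ≠ 0 := by exact_mod_cast hA
  have h2A : (2 : ℝ) * K.A ≠ 0 := mul_ne_zero two_ne_zero hA'
  refine ⟨hD ▸ sq_nonneg _, ?_⟩
  rw [lox, hix, hD, Real.sqrt_sq_eq_abs]
  rcases le_total 0 (2 * K.A * y + K.Bx x) with h0 | h0
  · left
    rw [abs_of_nonneg h0]
    field_simp
    ring
  · right
    rw [abs_of_nonpos h0]
    field_simp
    ring

/-- For `A < 0` the root `(−B + √D)/(2A)` is the lower one. [folklore] -/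
theorem lox_le_hix (hA : K.A < 0) (x : ℝ) : K.lox x ≤ K.hix x := by
  have h2A : (2 : ℝ) * K.A ≤ 0 := by
    have : (K.A : ℝ) < 0 := by exact_mod_cast hA
    linarith
  exact div_le_div_of_nonpos_of_le h2A (by linarith [Real.sqrt_nonneg (K.Dx x)])

end Conic

/-- `Fin.init z 0 = z 0` on `Fin 2` (private per-file copy; a verbatim twin is landed elsewhere in the tree). [folklore] -/
@[simp] private theorem init_apply_zero₂ (z : Fin 2 → ℝ) : Fin.init z 0 = z 0 := rfl

/-- `Fin.last 1 = 1` in `Fin 2` (private per-file copy; a verbatim twin is landed elsewhere in the tree). [folklore] -/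
@[simp] private theorem last_one₂ : (Fin.last 1 : Fin 2) = 1 := rfl

/-- The unit-square condition on `Fin 2 → ℝ`, unfolded to the two coordinates. [folklore] -/
theorem forall_fin_two_iff {z : Fin 2 → ℝ} :
    (∀ j, 0 < z j ∧ z j < 1) ↔ (0 < z 0 ∧ z 0 < 1) ∧ (0 < z 1 ∧ z 1 < 1) := by
  rw [Fin.forall_fin_two]

/-! #### 7. The conic cell with `A < 0`: one band between the roots -/

/-- **`A < 0`.** The weighted conic cell `[{(x,y) ∈ (0,1)² | p > 0}, q]` with `A < 0` lands in
the Baker sector, given square-root descent for its discriminant: it is the band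
`κ(lo) < y < κ(hi)` over `{D > 0}` (rule 3 with primitive `q·y`), and `[X, q·κ(m ± √D/(2|A|))]`
splits (rule 1) into a vanishing piece, a rational constant, a polynomial and `γ·√D`.
[KontsevichZagier2001 §1.2; this node] -/
theorem inBaker_cell_of_neg (K : Conic) (hA : K.A < 0) (q : ℚ)
    (hS : ∀ γ : ℚ, SqrtDescent K.e K.f K.g γ) (ρ : KZ.IntegralRep 2) (hdom : ρ.domain = K.cell)
    (hint : ∀ z ∈ ρ.domain, ρ.integrand z = q) : InBaker (KZ.of ρ) := by
  have hA0 : (K.A : ℝ) ≠ 0 := by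
    have : (K.A : ℝ) < 0 := by exact_mod_cast hA
    exact this.ne
  -- the base `S = {x ∈ (0,1) | D(x) > 0}` and the clamped root functions
  set S : Set (Fin 1 → ℝ) := {v | v ∈ unitIoo ∧ 0 < K.Dx (v 0)} with hSdef
  have hSs : IsSemialgebraic ℚ S :=
    IsSemialgebraicFunOn.isSemialgebraic_sep_pos (K.isSemialgebraicFunOn_Dx isSemialgebraic_unitIoo)
  have hSI : S ⊆ Icc 0 1 := fun v hv => unitIoo_subset_Icc hv.1
  have hlo : IsSemialgebraicFunOn ℚ S fun v => K.lox (v 0) := K.isSemialgebraicFunOn_lox hSs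
  have hhi : IsSemialgebraicFunOn ℚ S fun v => K.hix (v 0) := K.isSemialgebraicFunOn_hix hSs
  have hl : IsSemialgebraicFunOn ℚ S fun v => clamp (K.lox (v 0)) :=
    IsSemialgebraicFunOn.clamp hSs hlo
  have hu : IsSemialgebraicFunOn ℚ S fun v => clamp (K.hix (v 0)) :=
    IsSemialgebraicFunOn.clamp hSs hhi
  have hl0 : ∀ v ∈ S, 0 ≤ clamp (K.lox (v 0)) := fun v _ => clamp_nonneg _
  have hu1 : ∀ v ∈ S, clamp (K.hix (v 0)) ≤ 1 := fun v _ => clamp_le_one _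
  have hlu : ∀ v ∈ S, clamp (K.lox (v 0)) ≤ clamp (K.hix (v 0)) := fun v _ =>
    clamp_mono (K.lox_le_hix hA _)
  -- step 1: the cell IS the open band
  have hdomeq : ρ.domain = oband S (fun v => clamp (K.lox (v 0))) fun v => clamp (K.hix (v 0)) := by
    rw [hdom]
    ext z
    simp only [Conic.cell, mem_setOf_eq, mem_oband, hSdef, mem_unitIoo, init_apply_zero₂,
      forall_fin_two_iff]
    constructor
    · rintro ⟨⟨hx, hy⟩, hp⟩
      obtain ⟨hD, h1, h2⟩ := (K.pos_iff_of_neg hA _ _).1 hp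
      exact ⟨⟨hx, hD⟩, (clamp_lt_iff hy.1 hy.2).2 h1, (lt_clamp_iff hy.1 hy.2).2 h2⟩
    · rintro ⟨⟨hx, hD⟩, h1, h2⟩
      have hy0 : 0 < z (Fin.last 1) := (clamp_nonneg _).trans_lt h1
      have hy1 : z (Fin.last 1) < 1 := h2.trans_le (clamp_le_one _)
      exact ⟨⟨hx, hy0, hy1⟩, (K.pos_iff_of_neg hA _ _).2
        ⟨hD, (clamp_lt_iff hy0 hy1).1 h1, (lt_clamp_iff hy0 hy1).1 h2⟩⟩
  have h1 : KZ.of ρ - KZ.of (bandRep S hSs hSI _ _ hl hu hl0 hu1 q) ∈ KZ.relations :=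
    KZ.of_sub_of_mem_relations_of_eqOn (by rw [bandRep_domain, hdomeq]) fun z hz => by
      rw [hint z hz]; rfl
  have h2 := of_bandRep_sub_of_lenRep_mem_relations S hSs hSI _ _ hl hu hl0 hlu hu1 q
  -- step 3: the length integrand `q·(κ hi − κ lo)` splits
  suffices h3 : InBaker (KZ.of (lenRep S hSs hSI _ _ hl hu hl0 hlu hu1 q)) by
    refine h3.congr ?_
    have : KZ.of ρ - KZ.of (lenRep S hSs hSI _ _ hl hu hl0 hlu hu1 q) =
        (KZ.of ρ - KZ.of (bandRep S hSs hSI _ _ hl hu hl0 hu1 q)) +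
          (KZ.of (bandRep S hSs hSI _ _ hl hu hl0 hu1 q) -
            KZ.of (lenRep S hSs hSI _ _ hl hu hl0 hlu hu1 q)) := by abel
    rw [this]
    exact add_mem h1 h2
  -- the inner descents on `{0 ≤ root ≤ 1}`: polynomial part + `γ·√D`
  have inner : ∀ (δ ε : ℚ) (w : ℝ → ℝ)
      (hw : ∀ x, w x = (δ * K.Bx x + ε * √(K.Dx x)) / (2 * K.A))
      (r₁ : KZ.IntegralRep 1), r₁.domain ⊆ S →
      EqOn r₁.integrand (fun v => (q : ℝ) * w (v 0)) r₁.domain → InBaker (KZ.of r₁) := by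
    intro δ ε w hw r₁ hr₁S hr₁i
    have hr₁I : r₁.domain ⊆ Icc 0 1 := hr₁S.trans hSI
    let r₂ := polyRep₁ r₁.domain r₁.isSemialgebraic_domain hr₁I
      (MvPolynomial.C (q * δ / (2 * K.A)) * K.Bp)
    refine InBaker.of_sub' r₁ r₂ rfl (InBaker.of_eqOn_aeval r₂ _ fun v _ => rfl) ?_
    refine hS (q * ε / (2 * K.A)) _ fun v hv => ?_
    have hv' : v ∈ r₁.domain := hv
    change r₁.integrand v - aeval v (MvPolynomial.C (q * δ / (2 * K.A)) * K.Bp) =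
      ((q * ε / (2 * K.A) : ℚ) : ℝ) * √((K.e : ℝ) * v 0 ^ 2 + K.f * v 0 + K.g)
    rw [← K.Dx_eq (v 0), hr₁i hv']
    simp only [hw, map_mul, MvPolynomial.aeval_C, Conic.aeval_Bp, eq_ratCast]
    push_cast
    field_simp
    ring
  refine InBaker.of_sub' _ (bddRep S hSs ((isCompact_Icc (a := (0 : Fin 1 → ℝ)) (b := 1)).isBounded.subset hSI)
    (fun v => (q : ℝ) * clamp (K.hix (v 0)))
    (IsSemialgebraicFunOn.mul_holds (isSemialgebraicFunOn_ratCast hSs q) hu) |(q : ℝ)|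
    fun v _ => by
      rw [abs_mul]
      exact mul_le_of_le_one_right (abs_nonneg _)
        (abs_le.2 ⟨by linarith [clamp_nonneg (K.hix (v 0))], clamp_le_one _⟩)) rfl ?_ ?_
  · -- `[S, q·κ(hi)]`
    refine InBaker.clamp_descent hSs hhi q (fun r₁ hr₁ hr₁i => ?_) _ rfl fun v _ => rfl
    exact inner (-1) (-1) K.hix (fun x => by simp only [Conic.hix]; push_cast; ring) r₁
      (fun v hv => by rw [hr₁] at hv; exact hv.1) hr₁i
  · -- `[S, −q·κ(lo)]`
    refine InBaker.clamp_descent hSs hlo (-q) (fun r₁ hr₁ hr₁i => ?_) _ rfl fun v _ => by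
      simp only [subRep_integrand, lenRep, bddRep_integrand]; push_cast; ring
    exact inner 1 (-1) (fun x => -K.lox x) (fun x => by simp only [Conic.lox]; push_cast; ring) r₁
      (fun v hv => by rw [hr₁] at hv; exact hv.1) fun v hv => by
        rw [hr₁i hv]; push_cast; ring

/-- A representation whose domain is a weighted open band with edges in `[0,1]` over `X ⊆ [0,1]^N`
lands in the Baker sector as soon as its length representation `[X, q·(u − l)]` does (rule 3).
[KontsevichZagier2001 §1.2 rule (3); this node] -/
theorem InBaker.of_band {N : ℕ} (ρ : KZ.IntegralRep (N + 1)) (X : Set (Fin N → ℝ))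
    (hXs : IsSemialgebraic ℚ X) (hX : X ⊆ Icc 0 1) (l u : (Fin N → ℝ) → ℝ)
    (hl : IsSemialgebraicFunOn ℚ X l) (hu : IsSemialgebraicFunOn ℚ X u) (hl0 : ∀ x ∈ X, 0 ≤ l x)
    (hlu : ∀ x ∈ X, l x ≤ u x) (hu1 : ∀ x ∈ X, u x ≤ 1) (q : ℚ) (hdom : ρ.domain = oband X l u)
    (hint : ∀ z ∈ ρ.domain, ρ.integrand z = q)
    (h : InBaker (KZ.of (lenRep X hXs hX l u hl hu hl0 hlu hu1 q))) : InBaker (KZ.of ρ) := by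
  have h1 : KZ.of ρ - KZ.of (bandRep X hXs hX l u hl hu hl0 hu1 q) ∈ KZ.relations :=
    KZ.of_sub_of_mem_relations_of_eqOn (by rw [bandRep_domain, hdom]) fun z hz => by
      rw [hint z hz]; rfl
  have h2 := of_bandRep_sub_of_lenRep_mem_relations X hXs hX l u hl hu hl0 hlu hu1 q
  refine h.congr ?_
  have : KZ.of ρ - KZ.of (lenRep X hXs hX l u hl hu hl0 hlu hu1 q) =
      (KZ.of ρ - KZ.of (bandRep X hXs hX l u hl hu hl0 hu1 q)) +
        (KZ.of (bandRep X hXs hX l u hl hu hl0 hu1 q) - KZ.of (lenRep X hXs hX l u hl hu hl0 hlu hu1 q)) := by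
    abel
  rw [this]
  exact add_mem h1 h2

end Summit.KontsevichZagierPeriods.RootDecompWalshStrata.ConicDescent

end
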